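import Summits.QuantumFields.QCD.Theses.EulerDescent
import Literature.MathematicalPhysics.QuantumFieldTheory.QCDCurrentSector
import Summits.QuantumFields.QCD.Theorems.EulerDescentChiralCornerSoftnessStubCondensateFluxFloorNondegTwo
import Literature.Barriers.QuantumFields.WilsonDeterminantMassSplitting
import Literature.Barriers.QuantumFields.WilsonDeterminantSign
import HarnessLib

/-!
# Sub-goal `stub_condensateFluxFloor_denominatorReal` of line `Sketch`
(crux `Summit.QuantumFields.QCD.Theses.EulerDescent.ChiralCornerSoftness`, item stmt-QuantumFields-16902)

**The denominator of the twisted torus expectation is REAL for every `N_f` and every doublet `f ≠ g`.**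
For the twisted-mass Wilson doublet `(f, g)`, `f ≠ g` in `Fin N_f`, at any inverse coupling `β`, degenerate bare
mass `m₀`, twisted mass `μ` and torus side `2S+1`, the gauge average of the Berezin weight
`Z(β, m₀, μ, S) = ∫dμ_W(U) ∫dψ̄dψ e^{−ψ̄(D_W(U,m₀) ⊗ 1 + iμγ₅ ⊗ τ³)ψ}` has zero imaginary part
(`twDenominator_im`; `stub_condensateFluxFloor_denominatorReal` is the registered signature — its `let Tw` is
textually the skeleton's twisted-mass matrix, i.e. `Matrix.reindex quarkEquiv quarkEquiv (twistQ f g μ)`).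

## Proof (everything is proved; no named fact is taken as a hypothesis)

Pointwise in the gauge field the weight is invariant under complex conjugation (`star_fermiIntegral_twWeight`):
* `NondegTwo.fermiIntegral_grassmannExp_quadratic_neg`, `NondegTwo.diracQ_add_twistQ`, `NondegTwo.det_flavDiag` —
  the weight is `det(D_W ⊗ 1 + iμΓ₅ ⊗ τ³) = ∏_{f'} det(D_W(U,m₀) + s_{f'}·iμ Γ₅)` with `s = +1, −1, 0` on `f`, `g`,
  the other flavours (`Γ₅ = 1 ⊗ 1 ⊗ γ₅`);
* `star_det_add_smul` — by `γ₅`-Hermiticity `Γ₅ D_W Γ₅ = D_W†`, `Γ₅† = Γ₅`, `Γ₅² = 1`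
  (`isGammaHermitian_wilsonDirac`, Montvay–Münster (5.15)–(5.16)) one has
  `conj det(D_W + cΓ₅) = det((D_W + cΓ₅)†) = det(Γ₅ (D_W + c̄Γ₅) Γ₅) = det(D_W + c̄ Γ₅)`;
* `twSign_swap`, `star_twSign_mul` — `conj(s_{f'}·iμ) = −s_{f'}·iμ = s_{σ f'}·iμ` for the flavour transposition
  `σ = (f g)`, so conjugation permutes the factors of the product and `conj F(U) = F(U)` (`Equiv.prod_comp`).
Finally `conj Z = ∫ conj F dμ_W = ∫ F dμ_W = Z` (`integral_conj`, no integrability needed), i.e. `Im Z = 0`.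

References: R. Frezzotti, P. A. Grassi, S. Sint, P. Weisz, JHEP 08 (2001) 058, §2.1 (twisted-mass lattice QCD, the
doublet determinant `det(D_W + iμγ₅τ³) = det(Q² + μ²)` is real); I. Montvay, G. Münster, *Quantum Fields on a Lattice*
(CUP 1994), §5.1.2 (5.15)–(5.16) (`γ₅`-Hermiticity and reality of the Wilson determinant).
-/

noncomputable section

namespace Summit.QuantumFields.QCD.Cruxes.ChiralCornerSoftness.TwistedRay

open Filter Topology MeasureTheory
open Literature.MathematicalPhysics.QuantumFieldTheory Literature.MathematicalPhysics.QuantumLattice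
  Literature.Probability.LatticeModels

namespace DenominatorReal

open SlabFluxWard NondegTwo
open Literature.Barriers.QuantumFields Literature.Barriers.QuantumFields.WilsonSign

/-! ### Complex conjugation of a `Γ`-Hermitian block shifted by a multiple of `Γ` -/

section GammaHermitian

variable {n : Type*} [Fintype n] [DecidableEq n]

/-- **Conjugating the determinant of `D + cΓ` conjugates `c`** for a `Γ`-Hermitian `D` with Hermitian involutive
`Γ`: `conj det(D + cΓ) = det((D + cΓ)ᴴ) = det(ΓDΓ + c̄Γ) = det(Γ(D + c̄Γ)Γ) = det(D + c̄Γ)`.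
[cite: MontvayMunster1994, §5.1.2 (5.15)–(5.16)] -/
theorem star_det_add_smul {Γ D : Matrix n n ℂ} (h : IsGammaHermitian Γ D) (hΓ : Γ.conjTranspose = Γ) (c : ℂ) :
    star (D + c • Γ).det = (D + star c • Γ).det := by
  rw [← Matrix.det_conjTranspose, Matrix.conjTranspose_add, Matrix.conjTranspose_smul, hΓ, ← h.conj_eq]
  have hdet : Γ.det * Γ.det = 1 := by rw [← Matrix.det_mul, h.sq_eq_one, Matrix.det_one]
  have e : Γ * D * Γ + star c • Γ = Γ * (D + star c • Γ) * Γ := by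
    rw [Matrix.mul_add, Matrix.add_mul, Matrix.mul_smul, h.sq_eq_one, Matrix.smul_mul, Matrix.one_mul]
  rw [e, Matrix.det_mul, Matrix.det_mul, mul_right_comm, hdet, one_mul]

end GammaHermitian

/-! ### Conjugation swaps the two twisted flavours -/

section Flavour

variable {Nf : ℕ}

/-- The flavour transposition `(f g)` flips the sign of the twisted mass: `s_{σ f'} = −s_{f'}`. [folklore] -/
theorem twSign_swap {f g : Fin Nf} (hfg : f ≠ g) (f' : Fin Nf) :
    twSign f g (Equiv.swap f g f') = -twSign f g f' := by
  unfold twSign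
  by_cases h1 : f' = f
  · subst h1
    rw [Equiv.swap_apply_left, if_neg (Ne.symm hfg), if_pos rfl, if_pos rfl]
  · by_cases h2 : f' = g
    · subst h2
      rw [Equiv.swap_apply_right, if_pos rfl, if_neg h1, if_pos rfl, neg_neg]
    · rw [Equiv.swap_apply_of_ne_of_ne h1 h2, if_neg h1, if_neg h2, neg_zero]

/-- The twisted-mass sign is real. [folklore] -/
theorem star_twSign (f g f' : Fin Nf) : star (twSign f g f') = twSign f g f' := by
  unfold twSign
  split_ifs <;> simp

/-- **Conjugation swaps the twisted flavours**: `conj(s_{f'}·iμ) = s_{σ f'}·iμ`, `σ = (f g)`.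
[cite: FrezzottiGrassiSintWeisz2001, §2.1] -/
theorem star_twSign_mul {f g : Fin Nf} (hfg : f ≠ g) (μl : ℝ) (f' : Fin Nf) :
    star (twSign f g f' * ((μl : ℂ) * Complex.I)) = twSign f g (Equiv.swap f g f') * ((μl : ℂ) * Complex.I) := by
  rw [twSign_swap hfg, star_mul', star_twSign, star_mul', Complex.star_def, Complex.conj_ofReal, Complex.conj_I]
  ring

end Flavour

/-! ### The twisted weight is pointwise real; the denominator is real -/

section Weight

variable {Nf L : ℕ} [NeZero L]

/-- **The twisted Berezin weight at fixed gauge field is invariant under complex conjugation**: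
`conj ∏_{f'} det(D_W + s_{f'}·iμΓ₅) = ∏_{f'} det(D_W + s_{σ f'}·iμΓ₅) = ∏_{f'} det(D_W + s_{f'}·iμΓ₅)` — the
`f`- and `g`-blocks are exchanged (`det(D_W + iμΓ₅)·det(D_W − iμΓ₅) = det(Q² + μ²)` real, `Q = Γ₅D_W`), every
other block `det D_W(U, m₀)` is real by `γ₅`-Hermiticity.
[cite: FrezzottiGrassiSintWeisz2001, §2.1] [cite: MontvayMunster1994, §5.1.2 (5.15)–(5.16)] -/
theorem star_fermiIntegral_twWeight {f g : Fin Nf} (hfg : f ≠ g)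
    (U : GaugeConfig 4 L (Matrix.specialUnitaryGroup (Fin 3) ℂ)) (m₀ μl : ℝ) :
    (starRingEnd ℂ) (fermiIntegral (grassmannExp (quadratic ℂ (-(diracMatrix U (fun _ : Fin Nf => m₀) +
        Matrix.reindex quarkEquiv quarkEquiv (twistQ f g μl)))))) =
      fermiIntegral (grassmannExp (quadratic ℂ (-(diracMatrix U (fun _ : Fin Nf => m₀) +
        Matrix.reindex quarkEquiv quarkEquiv (twistQ f g μl))))) := by
  have hre : diracMatrix U (fun _ : Fin Nf => m₀) + Matrix.reindex quarkEquiv quarkEquiv (twistQ f g μl) =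
      Matrix.reindex quarkEquiv quarkEquiv (diracQ U m₀ + twistQ f g μl) := by
    rw [diracMatrix_eq_reindex_diracQ]; rfl
  have hH := isGammaHermitian_wilsonDirac (fundamentalRep (Fin 3)) fundamentalRep_mem_unitaryGroup U m₀ 1
  have hΓ := WilsonDeterminant.conjTranspose_spinorLift_gammaFive (L := L) (N := 3)
  rw [starRingEnd_apply, fermiIntegral_grassmannExp_quadratic_neg, hre, Matrix.det_reindex_self, diracQ_add_twistQ,
    det_flavDiag, star_prod]
  simp_rw [star_det_add_smul hH hΓ, star_twSign_mul hfg]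
  exact Equiv.prod_comp (Equiv.swap f g) fun f' => (wilsonDirac (fundamentalRep (Fin 3)) U m₀ 1 +
    (twSign f g f' * ((μl : ℂ) * Complex.I)) •
      (spinorLift gammaFive : Matrix (TorusSite 4 L × Fin 3 × Fin 4) (TorusSite 4 L × Fin 3 × Fin 4) ℂ)).det

/-- **The twisted denominator is real for every `N_f` and `f ≠ g`**: `conj Z = ∫ conj F dμ_W = ∫ F dμ_W = Z`
(`integral_conj`; no integrability is needed), hence `Im Z = 0`. [cite: FrezzottiGrassiSintWeisz2001, §2.1] -/
theorem twDenominator_im {f g : Fin Nf} (hfg : f ≠ g) (β m₀ μl : ℝ) (S : ℕ) :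
    (∫ U, fermiIntegral (grassmannExp (quadratic ℂ (-(diracMatrix U (fun _ : Fin Nf => m₀) +
          Matrix.reindex quarkEquiv quarkEquiv (twistQ f g μl)))))
        ∂(wilsonMeasure (d := 4) (L := 2 * S + 1) (fundamentalRep (Fin 3)) β)).im = 0 := by
  rw [← Complex.conj_eq_iff_im, ← integral_conj]
  exact integral_congr_ae (Eventually.of_forall fun U => star_fermiIntegral_twWeight hfg U m₀ μl)

end Weight

end DenominatorReal

open DenominatorReal in
/-- **Registered sub-goal `stub_condensateFluxFloor_denominatorReal` of line `Sketch`: the denominator of the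
twisted torus expectation is real for every `N_f` and every doublet `f ≠ g`.**  For `f ≠ g` in `Fin N_f`, every `β`,
`m₀`, `μ` and torus side `2S+1`, `Im ∫dμ_W(U) ∫dψ̄dψ e^{−ψ̄(D_W(U,m₀) ⊗ 1 + iμγ₅ ⊗ τ³)ψ} = 0`: at fixed `U` the
Berezin weight `∏_{f'} det(D_W + s_{f'}·iμΓ₅)` is conjugation invariant (`DenominatorReal.star_fermiIntegral_twWeight`:
`γ₅`-Hermiticity conjugates each block into the block of the swapped flavour), and `conj ∫ = ∫ conj`.
The `let Tw` is textually the skeleton's twisted-mass matrix.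
[cite: FrezzottiGrassiSintWeisz2001, §2.1] [cite: MontvayMunster1994, §5.1.2 (5.15)–(5.16)] -/
theorem stub_condensateFluxFloor_denominatorReal : ∀ (Nf : ℕ) (f g : Fin Nf), f ≠ g → ∀ (β m₀ μl : ℝ) (S : ℕ), let Tw := fun (S : ℕ) (μl : ℝ) => Matrix.reindex (quarkEquiv (Nf := Nf) (L := 2 * S + 1)) quarkEquiv (Matrix.of fun v w : QuarkVar Nf (2 * S + 1) => if v.1 = w.1 ∧ v.2.1 = w.2.1 ∧ v.2.2.1 = w.2.2.1 then (if v.1 = f then (1 : ℂ) else if v.1 = g then -1 else 0) * ((μl : ℂ) * Complex.I) * gammaFive v.2.2.2 w.2.2.2 else 0); (∫ U, fermiIntegral (grassmannExp (quadratic ℂ (-(diracMatrix U (fun _ : Fin Nf => m₀) + Tw S μl)))) ∂(wilsonMeasure (d := 4) (L := 2 * S + 1) (fundamentalRep (Fin 3)) β)).im = 0 := by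
  intro Nf f g hfg β m₀ μl S
  dsimp only
  exact twDenominator_im hfg β m₀ μl S

end Summit.QuantumFields.QCD.Cruxes.ChiralCornerSoftness.TwistedRay

end
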